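import Summits.HubbardSuperconductivity.HubbardSuperconductivity.Theorems.SoloBlindTwistMomentum
import HarnessLib

/-!
# Momentum-resolved ground states exist, and the twisted competitor shares their momentum

Supplement to `SoloBlindTwistMomentum`. There the competitor `φ = W_mᴴψ` was shown to have the
same eigenvalue as `ψ` under every translation OF WHICH `ψ` IS AN EIGENVECTOR. Here we remove that
proviso by elementary harmonic analysis on the translation group `(ℤ/L)²`:

* `momProj[i, j] = L⁻¹ Σ_{a ∈ ℤ/L} χ(-ja) T_{a eᵢ}` (`χ = ZMod.stdAddChar`, `T = fockTranslate`) is the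
  projector onto crystal momentum `2πj/L` along axis `i`; `Σ_j momProj[i, j] = 1` (character
  orthogonality, `AddChar.sum_mulShift`; stated on vectors), `T_{b eᵢ} · momProj[i, j] = χ(jb) · momProj[i, j]`, and
  `momProj[i, j]` commutes with the Hubbard Hamiltonian, with all translations, and preserves the
  `(N, S^z)` sectors;
* `exists_groundState_translationEigenvector` — hence every `(N, S^z)` sector that has a ground state
  has a NORMALISED ground state which is a joint eigenvector of all lattice translations
  (a momentum-resolved ground state);
* `dWave_order_not_momentum_robust'` — combining with `dWave_order_not_momentum_robust`: for all
  `t, U`, every `c > 0`, with the same `L`-independent `ε` and `L₀`, on every torus of side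
  `L = n+1 ≥ L₀` with `L ∣ N`, every `(N, S^z)` sector possessing a ground state possesses a normalised
  momentum-resolved ground state `ψ` AND a normalised `φ` of the same sector with the SAME eigenvalue
  under EVERY translation, energy within `ε` of the sector ground energy, and `d`-wave order `< c L⁴`.

So hypotheses of the form "every low-energy state of fixed `(N, S^z, K)` has `d`-wave order `≥ cL⁴`"
are false for every `c > 0` along `L ∣ N` (no assumption on the ground states is left), which is the
precise sense in which momentum resolution does not rescue energy-robust versions of the summit
property (`SoloBlindOrderNotEnergyRobust`).

References: Lieb–Schultz–Mattis 1961; Watanabe, arXiv:1904.02700 p.5; character orthogonality on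
`ℤ/L` (Mathlib `AddChar.sum_mulShift`, `ZMod.isPrimitive_stdAddChar`). Elementary; [folklore].
-/

noncomputable section

namespace Summit.HubbardSuperconductivity.HubbardSuperconductivity.Theorems

open Matrix Finset Literature.MathematicalPhysics.QuantumLattice
  Literature.MathematicalPhysics.QuantumFieldTheory
open Literature.Probability.LatticeModels (TorusSite)
open scoped ComplexConjugate ComplexOrder

namespace GaugeTwist

variable {L : ℕ} [NeZero L]

/-- `T_{(a+b) eᵢ} = T_{a eᵢ} T_{b eᵢ}`. [folklore] -/
theorem fockTranslate_single_add (i : Fin 2) (a b : ZMod L) :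
    (fockTranslate (Pi.single i (a + b) : TorusSite 2 L)).val =
      (fockTranslate (Pi.single i a : TorusSite 2 L)).val *
        (fockTranslate (Pi.single i b : TorusSite 2 L)).val := by
  rw [Pi.single_add, fockTranslate_add]
  rfl

/- **Momentum projector** along axis `i` onto crystal momentum `2πj/L`:
`P_{i,j} = L⁻¹ Σ_{a ∈ ℤ/L} χ(-ja) T_{a eᵢ}` — a local notation, so that no new definition enters the
tree; every statement below is about this explicit matrix. -/
set_option quotPrecheck false in
local notation "momProj[" i ", " j "]" =>
  (((L : ℂ)⁻¹) • ∑ a : ZMod L,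
    (ZMod.stdAddChar (-(j * a)) : ℂ) • (fockTranslate (Pi.single i a : TorusSite 2 L)).val)

/-- **Covariance**: `T_{b eᵢ} P_{i,j} = χ(jb) P_{i,j}`. [folklore] -/
theorem fockTranslate_single_mul_momProj (i : Fin 2) (j b : ZMod L) :
    (fockTranslate (Pi.single i b : TorusSite 2 L)).val * momProj[i, j] =
      (ZMod.stdAddChar (j * b) : ℂ) • momProj[i, j] := by
  have key : ∀ a : ZMod L, (ZMod.stdAddChar (j * b) : ℂ) * ZMod.stdAddChar (-(j * (b + a))) =
      ZMod.stdAddChar (-(j * a)) := by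
    intro a
    rw [← AddChar.map_add_eq_mul]
    congr 1
    ring
  calc (fockTranslate (Pi.single i b : TorusSite 2 L)).val * momProj[i, j]
        = ((L : ℂ)⁻¹) • ∑ a : ZMod L, (ZMod.stdAddChar (-(j * a)) : ℂ) •
            (fockTranslate (Pi.single i (b + a) : TorusSite 2 L)).val := by
          rw [Matrix.mul_smul, Finset.mul_sum]
          congr 1
          refine Finset.sum_congr rfl fun a _ => ?_
          rw [Matrix.mul_smul, fockTranslate_single_add]
    _ = ((L : ℂ)⁻¹) • ∑ a : ZMod L,
            ((ZMod.stdAddChar (j * b) : ℂ) * ZMod.stdAddChar (-(j * (b + a)))) •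
            (fockTranslate (Pi.single i (b + a) : TorusSite 2 L)).val := by
          simp_rw [key]
    _ = ((L : ℂ)⁻¹) • ((ZMod.stdAddChar (j * b) : ℂ) • ∑ a : ZMod L,
            (ZMod.stdAddChar (-(j * a)) : ℂ) • (fockTranslate (Pi.single i a : TorusSite 2 L)).val) := by
          congr 1
          rw [Finset.smul_sum]
          simp_rw [smul_smul]
          exact Fintype.sum_equiv (Equiv.addLeft b) _ _ fun a => rfl
    _ = (ZMod.stdAddChar (j * b) : ℂ) • momProj[i, j] := by
          rw [smul_comm]

/-- **Completeness**: `Σ_j P_{i,j} ψ = ψ` (orthogonality of the characters of `ℤ/L`). [folklore] -/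
theorem sum_momProj_mulVec (i : Fin 2) (ψ : Fock (Orb (FermionTorus 2 L))) :
    ∑ j : ZMod L, momProj[i, j] *ᵥ ψ = ψ := by
  classical
  have hL : (L : ℂ) ≠ 0 := Nat.cast_ne_zero.2 (NeZero.ne L)
  have hchar : ∀ a : ZMod L, ∑ j : ZMod L, (ZMod.stdAddChar (-(j * a)) : ℂ) =
      if a = 0 then (L : ℂ) else 0 := by
    intro a
    have : ∑ j : ZMod L, (ZMod.stdAddChar (-(j * a)) : ℂ) =
        ∑ j : ZMod L, (ZMod.stdAddChar (j * (-a)) : ℂ) :=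
      Finset.sum_congr rfl fun j _ => by rw [mul_neg]
    rw [this, AddChar.sum_mulShift (-a) (ZMod.isPrimitive_stdAddChar L), ZMod.card]
    by_cases ha : a = 0 <;> simp [ha]
  have hsum : ∑ j : ZMod L, momProj[i, j] = (fockTranslate (0 : TorusSite 2 L)).val := by
    calc ∑ j : ZMod L, momProj[i, j]
        = ((L : ℂ)⁻¹) • ∑ a : ZMod L, (∑ j : ZMod L, (ZMod.stdAddChar (-(j * a)) : ℂ)) •
            (fockTranslate (Pi.single i a : TorusSite 2 L)).val := by
          rw [← Finset.smul_sum, Finset.sum_comm]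
          congr 1
          refine Finset.sum_congr rfl fun a _ => ?_
          rw [Finset.sum_smul]
      _ = ((L : ℂ)⁻¹) • ∑ a : ZMod L, (if a = 0 then
            (L : ℂ) • (fockTranslate (Pi.single i a : TorusSite 2 L)).val else 0) := by
          congr 1
          refine Finset.sum_congr rfl fun a _ => ?_
          rw [hchar a]
          split_ifs <;> simp
      _ = (fockTranslate (0 : TorusSite 2 L)).val := by
          rw [Finset.sum_ite_eq' Finset.univ (0 : ZMod L)]
          simp only [Finset.mem_univ, if_true, Pi.single_zero, smul_smul, inv_mul_cancel₀ hL,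
            one_smul]
  rw [← Matrix.sum_mulVec, hsum, fockTranslate_zero]
  simp

/-- `P_{i,j}` commutes with the Hubbard Hamiltonian. [folklore] -/
theorem momProj_commute_hubbardTorus (i : Fin 2) (j : ZMod L) (t U : ℝ) :
    Commute (momProj[i, j]) (hubbardTorus 2 L t U) := by
  refine Commute.smul_left ?_ _
  refine Commute.sum_left _ _ _ fun a _ => ?_
  exact Commute.smul_left (fockTranslate_commute_hubbardTorus _ t U) _

/-- `P_{i,j}` commutes with every translation. [folklore] -/
theorem fockTranslate_commute_momProj (u : TorusSite 2 L) (i : Fin 2) (j : ZMod L) :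
    Commute (fockTranslate u).val (momProj[i, j]) := by
  refine Commute.smul_right ?_ _
  refine Commute.sum_right _ _ _ fun a _ => ?_
  refine Commute.smul_right ?_ _
  have hgrp : fockTranslate u * fockTranslate (Pi.single i a : TorusSite 2 L) =
      fockTranslate (Pi.single i a : TorusSite 2 L) * fockTranslate u := by
    rw [← fockTranslate_add, ← fockTranslate_add, add_comm]
  exact congrArg Subtype.val hgrp

/-- `P_{i,j}` preserves the `(N, S^z)` sectors. [folklore] -/
theorem momProj_mulVec_mem_szSector (i : Fin 2) (j : ZMod L) {N : ℕ} {Mz : ℝ}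
    {ψ : Fock (Orb (FermionTorus 2 L))} (hψ : ψ ∈ szSector N Mz) :
    momProj[i, j] *ᵥ ψ ∈ szSector N Mz := by
  rw [Matrix.smul_mulVec, Matrix.sum_mulVec]
  refine Submodule.smul_mem _ _ (Submodule.sum_mem _ fun a _ => ?_)
  rw [Matrix.smul_mulVec]
  exact Submodule.smul_mem _ _ (fockTranslate_mulVec_mem_szSector _ hψ)

/-- `P_{i,j}` maps a sector ground state to a sector ground state (or to `0`). [folklore] -/
theorem IsGroundStateInSector.momProj_mulVec {t U : ℝ} {N : ℕ} {Mz : ℝ}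
    {ψ : Fock (Orb (FermionTorus 2 L))} (hψ : IsGroundStateInSector (hubbardTorus 2 L t U) N Mz ψ)
    (i : Fin 2) (j : ZMod L) (hne : momProj[i, j] *ᵥ ψ ≠ 0) :
    IsGroundStateInSector (hubbardTorus 2 L t U) N Mz (momProj[i, j] *ᵥ ψ) := by
  refine ⟨momProj_mulVec_mem_szSector i j hψ.1, hne, ?_⟩
  rw [mulVec_mulVec, ← (momProj_commute_hubbardTorus i j t U).eq, ← mulVec_mulVec, hψ.2.2,
    mulVec_smul]

/-- `P_{i,j}ψ` is a `T_{b eᵢ}`-eigenvector with eigenvalue `χ(jb)`. [folklore] -/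
theorem fockTranslate_single_mulVec_momProj_mulVec (i : Fin 2) (j b : ZMod L)
    (ψ : Fock (Orb (FermionTorus 2 L))) :
    (fockTranslate (Pi.single i b : TorusSite 2 L)).val *ᵥ (momProj[i, j] *ᵥ ψ) =
      (ZMod.stdAddChar (j * b) : ℂ) • (momProj[i, j] *ᵥ ψ) := by
  rw [mulVec_mulVec, fockTranslate_single_mul_momProj, Matrix.smul_mulVec]

/-- A nonzero vector has a normalised multiple. [folklore] -/
theorem exists_smul_unit {n : Type*} [Fintype n] {φ : n → ℂ} (hφ : φ ≠ 0) :
    ∃ c : ℂ, c ≠ 0 ∧ star (c • φ) ⬝ᵥ (c • φ) = 1 := by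
  have hr : (0 : ℂ) < star φ ⬝ᵥ φ := dotProduct_star_self_pos_iff.2 hφ
  have hre : 0 < (star φ ⬝ᵥ φ).re := (Complex.pos_iff.1 hr).1
  have him : (star φ ⬝ᵥ φ).im = 0 := (Complex.pos_iff.1 hr).2.symm
  set ρ : ℝ := (star φ ⬝ᵥ φ).re with hρdef
  have hρ : star φ ⬝ᵥ φ = (ρ : ℂ) := Complex.ext (by simp [hρdef]) (by simp [him])
  set c : ℝ := (Real.sqrt ρ)⁻¹ with hcdef
  have hc0 : c ≠ 0 := inv_ne_zero (Real.sqrt_pos.2 hre).ne'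
  have hcc : c * c * ρ = 1 := by
    rw [hcdef, ← mul_inv, Real.mul_self_sqrt hre.le, inv_mul_cancel₀ hre.ne']
  refine ⟨(c : ℂ), by exact_mod_cast hc0, ?_⟩
  rw [star_smul, smul_dotProduct, dotProduct_smul, smul_eq_mul, smul_eq_mul, hρ, Complex.star_def,
    Complex.conj_ofReal, ← mul_assoc]
  exact_mod_cast hcc

/-- **Momentum-resolved ground states exist**: every `(N, S^z)` sector with a ground state has a
normalised ground state that is a joint eigenvector of all lattice translations. [folklore] -/
theorem exists_groundState_translationEigenvector {t U : ℝ} {N : ℕ} {Mz : ℝ}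
    {ψ : Fock (Orb (FermionTorus 2 L))} (hψ : IsGroundStateInSector (hubbardTorus 2 L t U) N Mz ψ) :
    ∃ φ, IsGroundStateInSector (hubbardTorus 2 L t U) N Mz φ ∧ star φ ⬝ᵥ φ = 1 ∧
      ∀ v : TorusSite 2 L, ∃ μ : ℂ, (fockTranslate v).val *ᵥ φ = μ • φ := by
  classical
  -- resolve along axis 0
  have h1 : ∑ j : ZMod L, momProj[0, j] *ᵥ ψ = ψ := sum_momProj_mulVec 0 ψ
  have h1' : ∑ j : ZMod L, momProj[0, j] *ᵥ ψ ≠ 0 := by rw [h1]; exact hψ.2.1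
  obtain ⟨j₀, -, hj₀⟩ := Finset.exists_ne_zero_of_sum_ne_zero h1'
  have hφ₁ := IsGroundStateInSector.momProj_mulVec hψ 0 j₀ hj₀
  set φ₁ := momProj[0, j₀] *ᵥ ψ with hφ₁def
  -- then along axis 1
  have h2 : ∑ j : ZMod L, momProj[1, j] *ᵥ φ₁ = φ₁ := sum_momProj_mulVec 1 φ₁
  have h2' : ∑ j : ZMod L, momProj[1, j] *ᵥ φ₁ ≠ 0 := by rw [h2]; exact hφ₁.2.1
  obtain ⟨j₁, -, hj₁⟩ := Finset.exists_ne_zero_of_sum_ne_zero h2'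
  have hφ₂ := IsGroundStateInSector.momProj_mulVec hφ₁ 1 j₁ hj₁
  set φ₂ := momProj[1, j₁] *ᵥ φ₁ with hφ₂def
  have e1 : ∀ b : ZMod L, (fockTranslate (Pi.single 1 b : TorusSite 2 L)).val *ᵥ φ₂ =
      (ZMod.stdAddChar (j₁ * b) : ℂ) • φ₂ := fun b =>
    fockTranslate_single_mulVec_momProj_mulVec 1 j₁ b φ₁
  have e0 : ∀ b : ZMod L, (fockTranslate (Pi.single 0 b : TorusSite 2 L)).val *ᵥ φ₂ =
      (ZMod.stdAddChar (j₀ * b) : ℂ) • φ₂ := by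
    intro b
    rw [hφ₂def, mulVec_mulVec, (fockTranslate_commute_momProj _ 1 j₁).eq, ← mulVec_mulVec,
      hφ₁def, fockTranslate_single_mulVec_momProj_mulVec 0 j₀ b ψ, mulVec_smul]
  -- normalise
  obtain ⟨c, hc, hunit⟩ := exists_smul_unit hφ₂.2.1
  refine ⟨c • φ₂, ⟨Submodule.smul_mem _ _ hφ₂.1, smul_ne_zero hc hφ₂.2.1, ?_⟩, hunit, fun v => ?_⟩
  · rw [mulVec_smul, hφ₂.2.2, smul_comm]
  · have hv : v = Pi.single 0 (v 0) + Pi.single 1 (v 1) := by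
      funext k
      fin_cases k <;> simp
    have hgrp : fockTranslate v =
        fockTranslate (Pi.single 0 (v 0) : TorusSite 2 L) * fockTranslate (Pi.single 1 (v 1)) := by
      rw [← fockTranslate_add, ← hv]
    have hT : (fockTranslate v).val =
        (fockTranslate (Pi.single 0 (v 0) : TorusSite 2 L)).val *
          (fockTranslate (Pi.single 1 (v 1) : TorusSite 2 L)).val := congrArg Subtype.val hgrp
    refine ⟨ZMod.stdAddChar (j₀ * v 0) * ZMod.stdAddChar (j₁ * v 1), ?_⟩
    rw [hT, ← mulVec_mulVec, mulVec_smul, e1, mulVec_smul, mulVec_smul, e0,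
      smul_smul, smul_smul, smul_smul]
    congr 1
    ring

/-- **The ground-state d-wave order criterion is not robust with momentum resolution — no proviso.**
For all `t U` and every `c > 0` there are an `L`-independent `ε` and `L₀` such that on every torus of
side `L = n+1 ≥ L₀` with `L ∣ N`, every `(N, S^z)` sector that has a ground state has a normalised
ground state `ψ` that is a joint eigenvector of all translations, together with a normalised `φ` of
the same sector having the same eigenvalue as `ψ` under every translation, energy within `ε` of the
sector ground energy, and `re ⟨φ, Δ_d†Δ_d φ⟩ < c L⁴`. [folklore] -/
theorem dWave_order_not_momentum_robust' (t U c : ℝ) (hc : 0 < c) :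
    ∃ ε : ℝ, ∃ L₀ : ℕ, ∀ n : ℕ, L₀ ≤ n + 1 →
      ∀ {N : ℕ} {Mz : ℝ} {ψ₀ : Fock (Orb (FermionTorus 2 (n + 1)))},
        (N : ZMod (n + 1)) = 0 →
        IsGroundStateInSector (hubbardTorus 2 (n + 1) t U) N Mz ψ₀ →
        ∃ ψ φ : Fock (Orb (FermionTorus 2 (n + 1))),
          IsGroundStateInSector (hubbardTorus 2 (n + 1) t U) N Mz ψ ∧ star ψ ⬝ᵥ ψ = 1 ∧
          φ ∈ szSector N Mz ∧ star φ ⬝ᵥ φ = 1 ∧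
          (∀ v : TorusSite 2 (n + 1), ∃ μ : ℂ,
            (fockTranslate v).val *ᵥ ψ = μ • ψ ∧ (fockTranslate v).val *ᵥ φ = μ • φ) ∧
          (star φ ⬝ᵥ (hubbardTorus 2 (n + 1) t U *ᵥ φ)).re ≤
              (hubbardTorus 2 (n + 1) t U).minEnergyOn (szSector N Mz) + ε ∧
          (expect ((pairField dWaveFormFactor (n + 1))ᴴ * pairField dWaveFormFactor (n + 1)) φ).re <
            c * ((n : ℝ) + 1) ^ 4 := by
  obtain ⟨ε, L₀, h⟩ := dWave_order_not_momentum_robust t U c hc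
  refine ⟨ε, L₀, fun n hn N Mz ψ₀ hN hψ₀ => ?_⟩
  obtain ⟨ψ, hψ, hψ1, hmom⟩ := exists_groundState_translationEigenvector hψ₀
  obtain ⟨φ, hφ, hφ1, hE, hO, hφmom⟩ := h n hn hN hψ hψ1
  refine ⟨ψ, φ, hψ, hψ1, hφ, hφ1, fun v => ?_, hE, hO⟩
  obtain ⟨μ, hμ⟩ := hmom v
  exact ⟨μ, hμ, hφmom v μ hμ⟩

end GaugeTwist

end Summit.HubbardSuperconductivity.HubbardSuperconductivity.Theorems
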